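import Literature.AlgebraicGeometry.Motives.AbelianVarietyTheoremOfCubeProofs
import Literature.AlgebraicGeometry.Motives.TheoremOfCubeLocalProofs
import Literature.AlgebraicGeometry.Motives.SeesawGrauertGluingProofs
import Literature.AlgebraicGeometry.Motives.GrothendieckComplexFieldPointsProofs
import HarnessLib

/-!
# Discharged facts: the intermediate named facts of the Seesaw / Grauert / Theorem-of-the-Cube cone
# hold (Görtz–Wedhorn II, Cor. 23.135–23.137, Thm. 24.42, Thm. 24.66, Lemma 24.72)

The directory's formalisation of the Theorem of the Cube (Görtz–Wedhorn, *Algebraic Geometry II*,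
Thm. 24.73) was decomposed along its printed proof into named facts, each reduced — by theorems of
`Motives/AbelianVarietyTheoremOfCubeProofs`, `Motives/TheoremOfCubeLocalProofs`,
`Motives/SeesawGrauertGluingProofs`, `Motives/GrothendieckComplexFieldPointsProofs` and
`Motives/GrothendieckComplexSectionAlongCech` — to the single deep leaf
`cechComplex_pseudoCoherent_general` (Thm. 23.133 / Cor. 23.135: the Čech complex of `𝒪(D)` over
an affine open of the base of `pr_T : X ×_K T → T` is pseudo-coherent).  That leaf is PROVED
(`cechComplex_pseudoCoherent_general_holds`, `Motives/CechComplexPseudoCoherentGeneralProofs`), and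
the top of the cone was discharged with it (`theoremOfCube_linEquiv_holds`,
`cubicalStructure_linEquiv_holds`, `seesaw_isClosed_trivialLocus_holds`, …); but the discharges of
the INTERMEDIATE facts — each announced in its proof file as "the one-line application … to be
appended the moment `cechComplex_pseudoCoherent_general_holds` lands" — were never written.  This
file writes them (one line each; no statement is changed, no definition, no new named fact,
D-0026; net Literature debt **−12**):

* `cechComplex_perfect_holds` — Cor. 23.135 in Čech form: the Čech complex of `𝒪(D)` over an affine
  open is perfect (`cechComplex_perfect_of_general`);
* `grothendieckComplex_sectionsOver_holds`, `grothendieckComplex_sectionsOver_basicOpen_holds`,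
  `grothendieckComplex_sectionsFibre_holds`,
  `grothendieckComplex_sectionsFibre_fieldPoints_ofFiniteType_holds`,
  `grothendieckComplex_sectionAlong_holds` — Cor. 23.135 / Cor. 23.137 in degree `0` for `𝒪(D)` on
  `X ×_K T → T` (the "Grothendieck complex": a matrix over an affine neighbourhood whose kernels
  after base change compute `Γ(X_t, 𝒪(D_t))`, resp. sections along `T' → T`);
* `formalFunctions_exists_isSectionOver_restrict_holds` — the theorem on formal functions for `H⁰`
  of `𝒪(D)` (Thm. 24.42, `p = 0`);
* `seesaw_exists_linEquiv_classPullback_holds` — **the Seesaw Theorem** (Thm. 24.66): if every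
  `D_t` is trivial then `D ∼ pr_T^* M`;
* `isTrivialOver_nhds_of_trivialAlong_thickeningPt_holds` — Lemma 24.72, proof, Step (II);
* `theoremOfCube_isTrivialOver_nhds_locallyNoetherian_holds`, `theoremOfCube_isTrivialOver_nhds_holds`
  — the conclusion of Lemma 24.72 for `𝒪(D)` on `(X × Y) × T → T` (locally noetherian and general
  integral base);
* `theoremOfCube_isOpen_trivialLocus_holds` — openness of the trivial locus in the cube situation
  (Lemma 24.72 as used in the proof of Thm. 24.73).

## References

* U. Görtz, T. Wedhorn, *Algebraic Geometry II: Cohomology of Schemes*, Springer Spektrum (2023):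
  Thm. 23.133 with proof, Cor. 23.135, Cor. 23.137 (pp. 478–480), (23.28.5)–(23.28.6) (p. 482);
  Thm. 24.42 with (24.8.1) (p. 529); Thm. 24.66 with proof (pp. 544–546); Lemma 24.72 and
  Thm. 24.73 with proofs (pp. 548–550). [GortzWedhorn2023]
* D. Mumford, *Abelian Varieties* (1970), §5 (cohomology and base change), §6 (the theorem of the
  cube), §10. [MumfordAV1970]
-/

namespace Literature.AlgebraicGeometry.Motives

universe u

/-! ## Cor. 23.135 / 23.137: the Čech complex is perfect; the Grothendieck complex in degree `0` -/

/-- **Görtz–Wedhorn II, Cor. 23.135 in Čech form — the named fact `cechComplex_perfect` holds**: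
for `K` a field, `X → Spec K` proper and geometrically integral, `T` an integral `K`-scheme with
`X ×_K T` integral, `D` a Cartier divisor on `X ×_K T`, `V ⊆ T` an affine open and `𝔚` a Čech
cover of `pr_T⁻¹V`, the ordered Čech complex `Č•(𝔚, 𝒪(D))` receives a quasi-isomorphism from a
bounded complex of finitely generated projective `Γ(V, 𝒪_T)`-modules
(`cechComplex_perfect_of_general` applied to `cechComplex_pseudoCoherent_general_holds`).
[cite: GortzWedhorn2023, Cor. 23.135 (p. 480), via Thm. 23.133, proof, Steps (II)–(III) (pp. 478–479)] -/
theorem cechComplex_perfect_holds : cechComplex_perfect.{u} :=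
  cechComplex_perfect_of_general cechComplex_pseudoCoherent_general_holds

/-- **Görtz–Wedhorn II, Cor. 23.135 / Cor. 23.137 in degree `0` for `𝒪(D)` on `X ×_K T → T`, affine
form — the named fact `grothendieckComplex_sectionsOver` holds**
(`grothendieckComplex_sectionsOver_of_pseudoCoherent_general`, `Motives/AbelianVarietyTheoremOfCubeProofs`).
[cite: GortzWedhorn2023, Cor. 23.135 and Cor. 23.137 (p. 480)] -/
theorem grothendieckComplex_sectionsOver_holds : grothendieckComplex_sectionsOver.{u} :=
  grothendieckComplex_sectionsOver_of_pseudoCoherent_general cechComplex_pseudoCoherent_general_holds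

/-- **The basic-open form of the Grothendieck complex of `𝒪(D)` in degree `0` — the named fact
`grothendieckComplex_sectionsOver_basicOpen` holds**
(`grothendieckComplex_sectionsOver_basicOpen_of_pseudoCoherent_general`, `Motives/SeesawGrauertGluingProofs`).
[cite: GortzWedhorn2023, Cor. 23.135 and Cor. 23.137 (p. 480) with (23.28.5)–(23.28.6) (p. 482)] -/
theorem grothendieckComplex_sectionsOver_basicOpen_holds : grothendieckComplex_sectionsOver_basicOpen.{u} :=
  grothendieckComplex_sectionsOver_basicOpen_of_pseudoCoherent_general
    cechComplex_pseudoCoherent_general_holds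

/-- **The Grothendieck complex of `𝒪(D)` in degree `0` at the residue fields of an integral base —
the named fact `grothendieckComplex_sectionsFibre` holds**
(`grothendieckComplex_sectionsFibre_of_pseudoCoherent_general`, `Motives/GrothendieckComplexFieldPointsProofs`).
[cite: GortzWedhorn2023, Thm. 23.133, proof, Steps (I)–(IV) (pp. 478–479), with Cor. 23.135, Cor. 23.137 (p. 480)] -/
theorem grothendieckComplex_sectionsFibre_holds : grothendieckComplex_sectionsFibre.{u} :=
  grothendieckComplex_sectionsFibre_of_pseudoCoherent_general cechComplex_pseudoCoherent_general_holds

/-- **Cor. 23.137 in degree `0` over a base of finite type, at field-valued points — the named fact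
`grothendieckComplex_sectionsFibre_fieldPoints_ofFiniteType` holds**
(`grothendieckComplex_sectionsFibre_fieldPoints_ofFiniteType_of_pseudoCoherent_general`,
`Motives/GrothendieckComplexFieldPointsProofs`).
[cite: GortzWedhorn2023, Cor. 23.137 (p. 480), via Thm. 23.133, proof, Steps (II)–(III) and Cor. 23.135 (pp. 478–480)] -/
theorem grothendieckComplex_sectionsFibre_fieldPoints_ofFiniteType_holds :
    grothendieckComplex_sectionsFibre_fieldPoints_ofFiniteType.{u} :=
  grothendieckComplex_sectionsFibre_fieldPoints_ofFiniteType_of_pseudoCoherent_general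
    cechComplex_pseudoCoherent_general_holds

/-- **Görtz–Wedhorn II, Cor. 23.137 in degree `0` for `𝒪(D)` along a morphism `T' → T` — the named
fact `grothendieckComplex_sectionAlong` holds**
(`grothendieckComplex_sectionAlong_of_pseudoCoherent_general`, `Motives/AbelianVarietyTheoremOfCubeProofs`).
[cite: GortzWedhorn2023, Cor. 23.137 with Thm. 23.133, proof, and Cor. 23.135 (pp. 478–480)] -/
theorem grothendieckComplex_sectionAlong_holds : grothendieckComplex_sectionAlong.{u} :=
  grothendieckComplex_sectionAlong_of_pseudoCoherent_general cechComplex_pseudoCoherent_general_holds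

/-! ## Thm. 24.42 (`p = 0`) and the Seesaw Theorem (Thm. 24.66) -/

/-- **The theorem on formal functions for `H⁰` of `𝒪(D)` (Görtz–Wedhorn II, Thm. 24.42 for `p = 0`)
— the named fact `formalFunctions_exists_isSectionOver_restrict` holds**
(`formalFunctions_exists_isSectionOver_restrict_of_pseudoCoherent_general`,
`Motives/AbelianVarietyTheoremOfCubeProofs`).
[cite: GortzWedhorn2023, Thm. 24.42 with (24.8.1) (p. 529), via Cor. 23.137 (p. 480)] -/
theorem formalFunctions_exists_isSectionOver_restrict_holds :
    formalFunctions_exists_isSectionOver_restrict.{u} :=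
  formalFunctions_exists_isSectionOver_restrict_of_pseudoCoherent_general
    cechComplex_pseudoCoherent_general_holds

/-- **The Seesaw Theorem (Görtz–Wedhorn II, Thm. 24.66; Mumford §5 Cor. 6) — the named fact
`seesaw_exists_linEquiv_classPullback` holds**: for `K` a field, `X → Spec K` proper and
geometrically integral, `T` integral with `X ×_K T` integral and `D` a Cartier divisor on `X ×_K T`
all of whose fibres `D_t` are trivial, `D ∼ pr_T^* M` for a Cartier divisor `M` on `T`
(`seesaw_exists_linEquiv_classPullback_of_pseudoCoherent_general`, `Motives/AbelianVarietyTheoremOfCubeProofs`).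
[cite: GortzWedhorn2023, Thm. 24.66, proof (pp. 544–546), via Thm. 23.140 (3) (p. 483)]
[cite: MumfordAV1970, §5 Cor. 6] -/
theorem seesaw_exists_linEquiv_classPullback_holds : seesaw_exists_linEquiv_classPullback.{u} :=
  seesaw_exists_linEquiv_classPullback_of_pseudoCoherent_general cechComplex_pseudoCoherent_general_holds

/-! ## Lemma 24.72 and the openness of the trivial locus in the cube situation -/

/-- **Görtz–Wedhorn II, Lemma 24.72, proof, Step (II) — the named fact
`isTrivialOver_nhds_of_trivialAlong_thickeningPt` holds**
(`isTrivialOver_nhds_of_trivialAlong_thickeningPt_of_pseudoCoherent_general`,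
`Motives/AbelianVarietyTheoremOfCubeProofs`). [cite: GortzWedhorn2023, Lemma 24.72, proof, Step (II) (p. 549)] -/
theorem isTrivialOver_nhds_of_trivialAlong_thickeningPt_holds :
    isTrivialOver_nhds_of_trivialAlong_thickeningPt.{u} :=
  isTrivialOver_nhds_of_trivialAlong_thickeningPt_of_pseudoCoherent_general
    cechComplex_pseudoCoherent_general_holds

/-- **The conclusion of Görtz–Wedhorn II, Lemma 24.72 for `𝒪(D)` on `(X × Y) × T → T` over a general
integral base — the named fact `theoremOfCube_isTrivialOver_nhds` holds**
(`theoremOfCube_isTrivialOver_nhds_of_pseudoCoherent_general`, `Motives/TheoremOfCubeLocalProofs`).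
[cite: GortzWedhorn2023, Lemma 24.72, proof (pp. 548–549), with Thm. 23.133, Step (IV) (p. 479)] -/
theorem theoremOfCube_isTrivialOver_nhds_holds : theoremOfCube_isTrivialOver_nhds.{u} :=
  theoremOfCube_isTrivialOver_nhds_of_pseudoCoherent_general cechComplex_pseudoCoherent_general_holds

/-- **The locally noetherian case of Lemma 24.72 — the named fact
`theoremOfCube_isTrivialOver_nhds_locallyNoetherian` holds** (a special case of
`theoremOfCube_isTrivialOver_nhds_holds`, by
`theoremOfCube_isTrivialOver_nhds_locallyNoetherian_of_isTrivialOver_nhds` of `Motives/TheoremOfCubeLimit`).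
[cite: GortzWedhorn2023, Lemma 24.72, proof (pp. 548–549)] -/
theorem theoremOfCube_isTrivialOver_nhds_locallyNoetherian_holds :
    theoremOfCube_isTrivialOver_nhds_locallyNoetherian.{u} :=
  theoremOfCube_isTrivialOver_nhds_locallyNoetherian_of_isTrivialOver_nhds
    theoremOfCube_isTrivialOver_nhds_holds

/-- **Openness of the trivial locus in the cube situation (Görtz–Wedhorn II, Lemma 24.72 as used in
the proof of Thm. 24.73) — the named fact `theoremOfCube_isOpen_trivialLocus` holds**
(`theoremOfCube_isOpen_trivialLocus_of_pseudoCoherent_general`, `Motives/AbelianVarietyTheoremOfCubeProofs`).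
[cite: GortzWedhorn2023, Lemma 24.72 (p. 548) and proof of Thm. 24.73 (p. 550)] -/
theorem theoremOfCube_isOpen_trivialLocus_holds : theoremOfCube_isOpen_trivialLocus.{u} :=
  theoremOfCube_isOpen_trivialLocus_of_pseudoCoherent_general cechComplex_pseudoCoherent_general_holds

end Literature.AlgebraicGeometry.Motives
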